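import Summits.BirchSwinnertonDyer.BirchSwinnertonDyer.Theorems.ManinLocalTwoThreeQFareyFibreConnected
import Summits.BirchSwinnertonDyer.BirchSwinnertonDyer.Theorems.ManinLocalTwoThreeLemmaE

/-!
# E-an-143 — TELESCOPING: a LEVEL-LINEAR pattern of an even `Γ₀(N)`-cocycle function on the cusps has cocycle `≡ 0` on `Γ₁(N)`
# (MEMO-an §72.9, PROOFS-an-72; the combinatorial half of the paper edge `TowerExtension.RigidityImpliesTower`)

Summit `BirchSwinnertonDyer`, route `ManinLocalTwoThree` (cell bsd-f2-manin, analytic lens), cruxes C3 `ManinPrimeToThreeAtNine`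
(stmt-BirchSwinnertonDyer-22968) / C2 `ManinOddAtFour` (stmt-…-22967).  ABSTRACT SETTING (no modular forms): `G : ℚ → ℤ/p` with a cocycle
`c : SL(2,ℤ) → ℤ/p` such that `G(γx) − G(x) = c(γ)` for `γ₁₀ ≡ 0 (mod N)` and cusps `x = B/D` with `D` prime to `N` (hypothesis `hinv`,
written with the explicit image `(γ₀₀B + γ₀₁D)/(γ₁₀B + γ₁₁D)`), `G` even on such cusps, `G(ℤ) = 0`, and LEVEL-LINEAR on `ℤ[1/q]`:
`G(u/qᵐ) = κ'·m` (`q ∤ u`).  CONCLUSION: `c(γ) = 0` whenever `N ∣ γ₁₀`, `γ₁₁ ≡ 1 (mod N)`, `γ₁₁ ≠ 0`.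

PROOF.  (1) `κ'·o = 0` for the order `o` of `q mod N`: the lower unipotent `(1 0; −NK 1)`, `q^o = 1 + NK`, fixes `0` and maps `1/q^o ↦ 1`.
(2) If `q^{k₀} ≡ −1 (mod N)` then `κ'·k₀ = 0`: `δ = (a b; N q−N)` maps `1 ↦ (a+b)/q` and `r = 1 − qM ↦ −(ar+b)/q^{k₀+1}` (`q^{k₀}+1 = NM`).
(3) q-FAREY PATH INDUCTION (E-an-140 `qFareyFibreConnected_holds`): along `0 = x₀ ∼ x₁ ∼ … ∼ x_k = γ0 = B/D`, LEMMA E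
(`exists_gamma0_bottom_row_qPower`) purifies each edge into `ℤ[1/q]`, so `G(x_{i+1}) − G(x_i) = κ'(e_i − m_i)` with
`q^{m_i} D_{i+1} ≡ ε_i q^{e_i} D_i (mod N)`; the invariant «`G(x) = κ'm' − κ'm` and `q^m D_x ≡ ±q^{m'}`» reaches `γ0`, where `D ≡ ±1`
forces `q^m ≡ ±q^{m'}`, hence `m ≡ m'` or `m ≡ m' + k₀ (mod o)` — and `c(γ) = G(γ0) − G(0) = κ'(m' − m) = 0` by (1), (2).

* `isCoprime_moebius_apply` — `SL(2,ℤ)` preserves primitive vectors;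
* `levelLinear_telescope` — the statement above.

HONEST FRAMING: elementary; E-an-142 (the level-linearity INPUT) is p1/p2's `tvPatternRigidityLaw_holds`; nothing about Manin's conjecture or
BSD is asserted.  No definitions, no named facts, no sorry.
-/

set_option linter.dupNamespace false
set_option autoImplicit false

namespace Summit.BirchSwinnertonDyer.BirchSwinnertonDyer.Theorems.ManinLocalTwoThree

open Summit.BirchSwinnertonDyer.Rank1Residual.ManinAdditive.TowerExtension
open scoped MatrixGroups
open CongruenceSubgroup

/-- `SL(2,ℤ)` maps primitive vectors to primitive vectors. -/
theorem isCoprime_moebius_apply (δ : SL(2, ℤ)) {B D : ℤ} (h : IsCoprime B D) :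
    IsCoprime (δ 0 0 * B + δ 0 1 * D) (δ 1 0 * B + δ 1 1 * D) := by
  obtain ⟨u, v, huv⟩ := h
  have hdet : (δ 0 0 : ℤ) * δ 1 1 - δ 0 1 * δ 1 0 = 1 := by
    have := Matrix.det_fin_two (δ : Matrix (Fin 2) (Fin 2) ℤ)
    rw [δ.2] at this
    linarith
  exact ⟨u * δ 1 1 - v * δ 1 0, -(u * δ 0 1) + v * δ 0 0, by linear_combination (u * B + v * D) * hdet + huv⟩

/-- The denominator of `u / qᵐ` is prime to `N` (`q` prime, `q` prime to `N`). -/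
theorem coprime_den_div_primePow {N q : ℕ} (hq : q.Prime) (hqN : q.Coprime N) (u : ℤ) (m : ℕ) :
    Nat.Coprime ((u : ℚ) / (q : ℚ) ^ m).den N := by
  obtain ⟨i, hi⟩ := exists_den_qadic_eq_pow hq u m
  rw [hi]
  exact Nat.Coprime.pow_left i hqN

/-- **E-an-143 (telescoping)**: an even `Γ₀(N)`-cocycle function on the cusps prime to `N` that is LEVEL-LINEAR on `ℤ[1/q]` has cocycle
`c(γ) = 0` for every `γ` with `N ∣ γ₁₀`, `N ∣ γ₁₁ − 1`, `γ₁₁ ≠ 0`. -/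
theorem levelLinear_telescope {N q p : ℕ} [NeZero N] (hq : q.Prime) (hqN : q.Coprime N)
    (G : ℚ → ZMod p) (c : SL(2, ℤ) → ZMod p) (κ' : ZMod p)
    (hinv : ∀ γ : SL(2, ℤ), (N : ℤ) ∣ γ 1 0 → ∀ (B D : ℤ), D ≠ 0 → IsCoprime D (N : ℤ) →
      γ 1 0 * B + γ 1 1 * D ≠ 0 →
      G (((γ 0 0 * B + γ 0 1 * D : ℤ) : ℚ) / ((γ 1 0 * B + γ 1 1 * D : ℤ) : ℚ)) - G ((B : ℚ) / (D : ℚ)) = c γ)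
    (heven : ∀ x : ℚ, Nat.Coprime x.den N → G (-x) = G x)
    (hzero : ∀ u : ℤ, G (u : ℚ) = 0)
    (hlin : ∀ (m : ℕ) (u : ℤ), IsCoprime u (q : ℤ) → G ((u : ℚ) / (q : ℚ) ^ m) = κ' * (m : ZMod p))
    (γ : SL(2, ℤ)) (hγ0 : (N : ℤ) ∣ γ 1 0) (hγ1 : (N : ℤ) ∣ γ 1 1 - 1) (hγne : (γ 1 1 : ℤ) ≠ 0) :
    c γ = 0 := by
  have hq0 : (q : ℤ) ≠ 0 := by exact_mod_cast hq.ne_zero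
  have hqQ : (q : ℚ) ≠ 0 := by exact_mod_cast hq.ne_zero
  have hqNZ : IsCoprime (q : ℤ) (N : ℤ) := Nat.isCoprime_iff_coprime.mpr hqN
  -- level-linearity at a general `q`-power denominator `Q = ε qᵐ`
  have hlinQ : ∀ (m : ℕ) (u Q ε : ℤ), (ε = 1 ∨ ε = -1) → Q = ε * (q : ℤ) ^ m → IsCoprime u Q →
      G ((u : ℚ) / (Q : ℚ)) = κ' * (m : ZMod p) := by
    intro m u Q ε hε hQ huQ
    subst hQ
    rcases Nat.eq_zero_or_pos m with rfl | hm
    · rw [pow_zero, mul_one] at huQ ⊢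
      rcases hε with rfl | rfl
      · rw [Int.cast_one, div_one, hzero, Nat.cast_zero, mul_zero]
      · have : (u : ℚ) / ((-1 : ℤ) : ℚ) = ((-u : ℤ) : ℚ) := by push_cast; ring
        rw [this, hzero, Nat.cast_zero, mul_zero]
    · have huq : IsCoprime u (q : ℤ) :=
        (huQ.of_isCoprime_of_dvd_right (Dvd.intro_left ε rfl)).of_isCoprime_of_dvd_right (dvd_pow_self _ hm.ne')
      rcases hε with rfl | rfl
      · rw [one_mul, Int.cast_pow, Int.cast_natCast, hlin m u huq]
      · have : (u : ℚ) / ((-1 * (q : ℤ) ^ m : ℤ) : ℚ) = -((u : ℚ) / (q : ℚ) ^ m) := by push_cast; ring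
        rw [this, heven _ (coprime_den_div_primePow hq hqN u m), hlin m u huq]
  -- the unit `q mod N` and its order `o`
  set uq : (ZMod N)ˣ := ZMod.unitOfCoprime q hqN with huq_def
  have huq : (uq : ZMod N) = (q : ZMod N) := ZMod.coe_unitOfCoprime q hqN
  set o : ℕ := orderOf uq with ho
  have hqo : (q : ZMod N) ^ o = 1 := by
    rw [← huq, ← Units.val_pow_eq_pow_val, ho, pow_orderOf_eq_one, Units.val_one]
  -- (1) `κ' · o = 0`
  have hκo : κ' * (o : ZMod p) = 0 := by
    have hdvd : (N : ℤ) ∣ (q : ℤ) ^ o - 1 := by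
      apply (ZMod.intCast_zmod_eq_zero_iff_dvd _ N).mp
      push_cast
      rw [hqo, sub_self]
    obtain ⟨K, hK⟩ := hdvd
    obtain ⟨γL, h00, h01, h10, h11⟩ : ∃ γL : SL(2, ℤ), (γL 0 0 : ℤ) = 1 ∧ (γL 0 1 : ℤ) = 0 ∧
        (γL 1 0 : ℤ) = -((N : ℤ) * K) ∧ (γL 1 1 : ℤ) = 1 :=
      ⟨⟨!![1, 0; -((N : ℤ) * K), 1], by rw [Matrix.det_fin_two_of]; ring⟩, rfl, rfl, rfl, rfl⟩
    have hLN : (N : ℤ) ∣ γL 1 0 := by rw [h10]; exact ⟨-K, by ring⟩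
    -- `c γL = 0` (it fixes `0`)
    have hc0 : c γL = 0 := by
      have h := hinv γL hLN 0 1 one_ne_zero isCoprime_one_left (by rw [h11]; norm_num)
      rw [h00, h01, h10, h11] at h
      simp only [mul_zero, mul_one, zero_add, Int.cast_one, Int.cast_zero, div_one, sub_self] at h
      exact h.symm
    -- `1/q^o ↦ 1`
    have hden : γL 1 0 * 1 + γL 1 1 * (q : ℤ) ^ o ≠ 0 := by
      rw [h10, h11]; intro h; apply one_ne_zero (α := ℤ); linear_combination h - hK
    have h := hinv γL hLN 1 ((q : ℤ) ^ o) (pow_ne_zero _ hq0) (IsCoprime.pow_left hqNZ) hden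
    rw [h00, h01, h10, h11, hc0] at h
    have e1 : (((1 * 1 + 0 * (q : ℤ) ^ o : ℤ)) : ℚ) / ((-((N : ℤ) * K) * 1 + 1 * (q : ℤ) ^ o : ℤ) : ℚ) = ((1 : ℤ) : ℚ) := by
      have : (-((N : ℤ) * K) * 1 + 1 * (q : ℤ) ^ o : ℤ) = 1 := by linear_combination hK
      rw [this]; push_cast; ring
    rw [e1, hzero, zero_sub, neg_eq_zero] at h
    have e2 : (((1 : ℤ)) : ℚ) / (((q : ℤ) ^ o : ℤ) : ℚ) = ((1 : ℤ) : ℚ) / (q : ℚ) ^ o := by push_cast; ring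
    rw [e2, hlin o 1 isCoprime_one_left] at h
    exact h
  -- (2) if `q^{k₀} ≡ -1 (mod N)` then `κ' · k₀ = 0`
  have hκneg : ∀ k₀ : ℕ, (q : ZMod N) ^ k₀ = -1 → κ' * (k₀ : ZMod p) = 0 := by
    intro k₀ hk₀
    have hdvd : (N : ℤ) ∣ (q : ℤ) ^ k₀ + 1 := by
      apply (ZMod.intCast_zmod_eq_zero_iff_dvd _ N).mp
      push_cast
      rw [hk₀, neg_add_cancel]
    obtain ⟨M, hM⟩ := hdvd
    -- `δ = (a b; N q-N)`
    have hcop : IsCoprime ((q : ℤ) - N) (N : ℤ) := by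
      have := hqNZ.add_mul_left_left (-1)
      rwa [show (q : ℤ) + (N : ℤ) * (-1) = (q : ℤ) - N by ring] at this
    obtain ⟨a, b, hab⟩ := hcop
    obtain ⟨δ, h00, h01, h10, h11⟩ : ∃ δ : SL(2, ℤ), (δ 0 0 : ℤ) = a ∧ (δ 0 1 : ℤ) = -b ∧
        (δ 1 0 : ℤ) = (N : ℤ) ∧ (δ 1 1 : ℤ) = (q : ℤ) - N :=
      ⟨⟨!![a, -b; (N : ℤ), (q : ℤ) - N], by rw [Matrix.det_fin_two_of]; linear_combination hab⟩, rfl, rfl, rfl, rfl⟩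
    have hδN : (N : ℤ) ∣ δ 1 0 := by rw [h10]
    -- `1 ↦ (a - b)/q`
    have hx := hinv δ hδN 1 1 one_ne_zero isCoprime_one_left (by rw [h10, h11]; ring_nf; exact hq0)
    rw [h00, h01, h10, h11] at hx
    have ex : (((a * 1 + -b * 1 : ℤ)) : ℚ) / (((N : ℤ) * 1 + ((q : ℤ) - N) * 1 : ℤ) : ℚ) = ((a - b : ℤ) : ℚ) / (((q : ℤ) ^ 1 : ℤ) : ℚ) := by
      push_cast; ring
    have hcx : IsCoprime (a - b) ((q : ℤ) ^ 1) := ⟨-(N : ℤ), a, by linear_combination hab⟩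
    rw [ex, hlinQ 1 (a - b) ((q : ℤ) ^ 1) 1 (Or.inl rfl) (by ring) hcx] at hx
    have e11 : (((1 : ℤ)) : ℚ) / (((1 : ℤ)) : ℚ) = ((1 : ℤ) : ℚ) := by push_cast; ring
    rw [e11, hzero, sub_zero] at hx
    -- `r = 1 - qM ↦ -(ar + b)/q^{k₀+1}`
    set r : ℤ := 1 - (q : ℤ) * M with hr
    have hden : δ 1 0 * r + δ 1 1 * 1 = -1 * (q : ℤ) ^ (k₀ + 1) := by
      rw [h10, h11, hr, pow_succ]; linear_combination (q : ℤ) * hM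
    have hy := hinv δ hδN r 1 one_ne_zero isCoprime_one_left (by rw [hden]; exact mul_ne_zero (by norm_num) (pow_ne_zero _ hq0))
    have hcy : IsCoprime (δ 0 0 * r + δ 0 1 * 1) (δ 1 0 * r + δ 1 1 * 1) := isCoprime_moebius_apply δ isCoprime_one_right
    rw [hden] at hy hcy
    rw [hlinQ (k₀ + 1) _ _ (-1) (Or.inr rfl) rfl hcy] at hy
    have e1 : ((r : ℚ) / (((1 : ℤ)) : ℚ)) = ((r : ℤ) : ℚ) := by push_cast; ring
    rw [e1, hzero, sub_zero, ← hx] at hy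
    push_cast at hy
    linear_combination hy
  -- (3) the q-Farey path from `0` to `γ0 = B/D`
  have h11cop : IsCoprime (γ 1 1 : ℤ) (N : ℤ) := by
    obtain ⟨k, hk⟩ := hγ1
    exact ⟨1, -k, by linear_combination hk⟩
  have hdet : (γ 0 0 : ℤ) * γ 1 1 - γ 0 1 * γ 1 0 = 1 := by
    have := Matrix.det_fin_two (γ : Matrix (Fin 2) (Fin 2) ℤ)
    rw [γ.2] at this
    linarith
  -- sign-normalised end vertex
  obtain ⟨σ₀, hσ₀, hσpos⟩ : ∃ σ₀ : ℤ, (σ₀ = 1 ∨ σ₀ = -1) ∧ 0 < σ₀ * γ 1 1 := by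
    rcases lt_or_gt_of_ne hγne with h | h
    · exact ⟨-1, Or.inr rfl, by linarith⟩
    · exact ⟨1, Or.inl rfl, by linarith⟩
  have hσ₀2 : σ₀ * σ₀ = 1 := by rcases hσ₀ with rfl | rfl <;> norm_num
  set D : ℕ := (σ₀ * γ 1 1).toNat with hD
  have hDZ : (D : ℤ) = σ₀ * γ 1 1 := by rw [hD]; exact Int.toNat_of_nonneg hσpos.le
  set B : ℤ := σ₀ * γ 0 1 with hB
  have hDpos : 0 < D := by have := hDZ ▸ hσpos; exact_mod_cast this
  have hBD : IsCoprime B (D : ℤ) := by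
    rw [hDZ, hB]
    exact ⟨-(σ₀ * γ 1 0), σ₀ * γ 0 0, by linear_combination ((γ 0 0 : ℤ) * γ 1 1 - γ 0 1 * γ 1 0) * hσ₀2 + hdet⟩
  have hgcd : Int.gcd B D = 1 := Int.isCoprime_iff_gcd_eq_one.mp hBD
  have hDN : Nat.Coprime D N := by
    have h : IsCoprime (D : ℤ) (N : ℤ) := by
      rw [hDZ]
      rcases hσ₀ with rfl | rfl
      · rw [one_mul]; exact h11cop
      · rw [neg_one_mul]; exact h11cop.neg_left
    exact Nat.isCoprime_iff_coprime.mp h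
  have hγ11 : ((γ 1 1 : ℤ) : ZMod N) = 1 := by
    obtain ⟨k, hk⟩ := hγ1
    have : ((γ 1 1 : ℤ) : ZMod N) = (((γ 1 1 : ℤ) - 1 : ℤ) : ZMod N) + 1 := by push_cast; ring
    rw [this, hk]; push_cast; simp
  have hDmod : (D : ZMod N) = (σ₀ : ZMod N) := by
    have : ((D : ℤ) : ZMod N) = ((σ₀ * γ 1 1 : ℤ) : ZMod N) := by rw [hDZ]
    push_cast at this
    rw [this, hγ11, mul_one]
  have hfib : InFibre N q D := by
    refine ⟨hDN, 0, ?_⟩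
    rw [pow_zero, hDmod]
    rcases hσ₀ with rfl | rfl
    · left; push_cast; rfl
    · right; push_cast; rfl
  have hpath := qFareyFibreConnected_holds N q hq hqN (NeZero.pos N) B D hDpos hgcd hfib
  -- the invariant along the path
  obtain ⟨o', ho'⟩ : ∃ o' : ℕ, o = o' + 1 := ⟨o - 1, by have := (isOfFinOrder_of_finite uq).orderOf_pos; omega⟩
  have hP : ∀ v : ℤ × ℕ, Relation.ReflTransGen (QFareyAdj N q) ((0 : ℤ), 1) v →
      ∃ (m m' : ℕ) (σ : ℤ), (σ = 1 ∨ σ = -1) ∧ G ((v.1 : ℚ) / ((v.2 : ℤ) : ℚ)) = κ' * (m' : ZMod p) - κ' * (m : ZMod p) ∧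
        (q : ZMod N) ^ m * (v.2 : ZMod N) = (σ : ZMod N) * (q : ZMod N) ^ m' := by
    intro v hv
    induction hv with
    | refl =>
      refine ⟨0, 0, 1, Or.inl rfl, ?_, ?_⟩
      · have : (((0 : ℤ)) : ℚ) / ((((1 : ℕ) : ℤ)) : ℚ) = ((0 : ℤ) : ℚ) := by push_cast; ring
        simp only [this, hzero, Nat.cast_zero, mul_zero, sub_zero]
      · push_cast; ring
    | @tail x y _ hedge ih =>
      obtain ⟨mx, mx', σx, hσx, hGx, hCx⟩ := ih
      obtain ⟨hx2, hy2, hgx, hgy, ⟨hxN, ex, hex⟩, ⟨hyN, ey, hey⟩, e, he⟩ := hedge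
      -- signs of the two denominators in `±⟨q⟩`
      obtain ⟨sx, hsx, hsxe⟩ : ∃ sx : ℤ, (sx = 1 ∨ sx = -1) ∧ (x.2 : ZMod N) = (sx : ZMod N) * (q : ZMod N) ^ ex := by
        rcases hex with h | h
        · exact ⟨1, Or.inl rfl, by rw [h]; push_cast; ring⟩
        · exact ⟨-1, Or.inr rfl, by rw [h]; push_cast; ring⟩
      obtain ⟨sy, hsy, hsye⟩ : ∃ sy : ℤ, (sy = 1 ∨ sy = -1) ∧ (y.2 : ZMod N) = (sy : ZMod N) * (q : ZMod N) ^ ey := by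
        rcases hey with h | h
        · exact ⟨1, Or.inl rfl, by rw [h]; push_cast; ring⟩
        · exact ⟨-1, Or.inr rfl, by rw [h]; push_cast; ring⟩
      have hsx2 : ((sx : ℤ) : ZMod N) * (sx : ZMod N) = 1 := by
        rcases hsx with rfl | rfl <;> push_cast <;> ring
      have hε : sx * sy = 1 ∨ sx * sy = -1 := by
        rcases hsx with rfl | rfl <;> rcases hsy with rfl | rfl <;> norm_num
      have hε2 : ((sx * sy : ℤ) : ZMod N) * ((sx * sy : ℤ) : ZMod N) = 1 := by
        rcases hε with h | h <;> rw [h] <;> push_cast <;> ring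
      -- `y.2 ≡ (sx sy) q^t x.2 (mod N)` with `t = ey + o'·ex`
      have hpow : (q : ZMod N) ^ (ey + o' * ex) * (q : ZMod N) ^ ex = (q : ZMod N) ^ ey := by
        rw [← pow_add, show ey + o' * ex + ex = ey + o * ex by rw [ho']; ring, pow_add, pow_mul, hqo, one_pow, mul_one]
      have hrel : (((y.2 : ℕ) : ℤ) : ZMod N) =
          ((sx * sy : ℤ) : ZMod N) * (q : ZMod N) ^ (ey + o' * ex) * (((x.2 : ℕ) : ℤ) : ZMod N) := by
        push_cast
        rw [hsye, hsxe]
        linear_combination (-((sy : ZMod N) * (q : ZMod N) ^ ey)) * hsx2 +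
          (-((sx : ZMod N) * (sx : ZMod N) * (sy : ZMod N))) * hpow
      -- the q-Farey determinant with its sign
      obtain ⟨η, hη, hdet'⟩ : ∃ η : ℤ, (η = 1 ∨ η = -1) ∧ x.1 * (y.2 : ℤ) - y.1 * (x.2 : ℤ) = η * (q : ℤ) ^ e := by
        rcases abs_choice (x.1 * (y.2 : ℤ) - y.1 * (x.2 : ℤ)) with h | h
        · exact ⟨1, Or.inl rfl, by rw [one_mul, ← he, h]⟩
        · exact ⟨-1, Or.inr rfl, by rw [neg_one_mul, ← he, h, neg_neg]⟩
      have hBDx : IsCoprime x.1 (x.2 : ℤ) := Int.isCoprime_iff_gcd_eq_one.mpr hgx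
      have hBDy : IsCoprime y.1 (y.2 : ℤ) := Int.isCoprime_iff_gcd_eq_one.mpr hgy
      -- LEMMA E: the purifier `δ`
      obtain ⟨δ, hδ0, ⟨m₁, hm₁⟩, he'⟩ := exists_gamma0_bottom_row_qPower hq hqN hBDx hε hrel hη hdet'
      have hδN : (N : ℤ) ∣ δ 1 0 := (ZMod.intCast_zmod_eq_zero_iff_dvd _ N).mp (Gamma0_mem.mp hδ0)
      have hδ10 : ((δ 1 0 : ℤ) : ZMod N) = 0 := Gamma0_mem.mp hδ0
      have hxZ : ((x.2 : ℕ) : ℤ) ≠ 0 := by exact_mod_cast hx2.ne'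
      have hyZ : ((y.2 : ℕ) : ℤ) ≠ 0 := by exact_mod_cast hy2.ne'
      have hxNZ : IsCoprime ((x.2 : ℕ) : ℤ) (N : ℤ) := Nat.isCoprime_iff_coprime.mpr hxN
      have hyNZ : IsCoprime ((y.2 : ℕ) : ℤ) (N : ℤ) := Nat.isCoprime_iff_coprime.mpr hyN
      have hQx : δ 1 0 * x.1 + δ 1 1 * (x.2 : ℤ) ≠ 0 := by
        rw [hm₁]; exact mul_ne_zero (by rcases hε with h | h <;> rw [h] <;> norm_num) (pow_ne_zero _ hq0)
      have hQy : δ 1 0 * y.1 + δ 1 1 * (y.2 : ℤ) ≠ 0 := by rw [he']; exact pow_ne_zero _ hq0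
      have Gx := hinv δ hδN x.1 (x.2 : ℤ) hxZ hxNZ hQx
      have Gy := hinv δ hδN y.1 (y.2 : ℤ) hyZ hyNZ hQy
      have hcx := isCoprime_moebius_apply δ hBDx
      have hcy := isCoprime_moebius_apply δ hBDy
      rw [hm₁] at Gx hcx
      rw [he'] at Gy hcy
      rw [hlinQ m₁ _ _ (sx * sy) hε rfl hcx] at Gx
      rw [hlinQ e _ _ 1 (Or.inl rfl) (by ring) hcy] at Gy
      -- the congruences `δ₁₁ x.2 ≡ ε q^{m₁}`, `δ₁₁ y.2 ≡ q^e`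
      have h1 : ((δ 1 1 : ℤ) : ZMod N) * (x.2 : ZMod N) = ((sx * sy : ℤ) : ZMod N) * (q : ZMod N) ^ m₁ := by
        have := congrArg (Int.cast : ℤ → ZMod N) hm₁
        push_cast at this
        rw [hδ10, zero_mul, zero_add] at this
        push_cast
        exact this
      have h2 : ((δ 1 1 : ℤ) : ZMod N) * (y.2 : ZMod N) = (q : ZMod N) ^ e := by
        have := congrArg (Int.cast : ℤ → ZMod N) he'
        push_cast at this
        rw [hδ10, zero_mul, zero_add] at this
        exact this
      refine ⟨mx + m₁, mx' + e, σx * (sx * sy), ?_, ?_, ?_⟩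
      · rcases hσx with rfl | rfl <;> rcases hε with h | h <;> rw [h] <;> norm_num
      · push_cast
        linear_combination (-1 : ZMod p) * Gy + Gx + hGx
      · push_cast at hε2 h1 ⊢
        rw [pow_add, pow_add]
        linear_combination (-(((sx : ZMod N) * (sy : ZMod N))) * (q : ZMod N) ^ mx * (y.2 : ZMod N)) * h1 +
          (((sx : ZMod N) * (sy : ZMod N)) * (q : ZMod N) ^ mx * (x.2 : ZMod N)) * h2 +
          (((sx : ZMod N) * (sy : ZMod N)) * (q : ZMod N) ^ e) * hCx +
          (-((q : ZMod N) ^ mx * (q : ZMod N) ^ m₁ * (y.2 : ZMod N))) * hε2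
  -- (4) at the end vertex `γ0 = B/D`
  obtain ⟨m, m', σ, hσ, hG, hC⟩ := hP (B, D) hpath
  have hG0 : G 0 = 0 := by have := hzero 0; rwa [Int.cast_zero] at this
  -- `c γ = G(γ0) − G(0)`
  have hcγ : c γ = κ' * (m' : ZMod p) - κ' * (m : ZMod p) := by
    have h := hinv γ hγ0 0 1 one_ne_zero isCoprime_one_left (by rw [mul_zero, zero_add, mul_one]; exact hγne)
    simp only [mul_zero, zero_add, mul_one, Int.cast_zero, Int.cast_one, div_one, hG0, sub_zero] at h
    rw [← h]
    have e : ((γ 0 1 : ℤ) : ℚ) / ((γ 1 1 : ℤ) : ℚ) = ((B : ℤ) : ℚ) / (((D : ℕ) : ℤ) : ℚ) := by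
      rw [hDZ, hB]
      have hσQ : ((σ₀ : ℤ) : ℚ) ≠ 0 := by rcases hσ₀ with rfl | rfl <;> norm_num
      push_cast
      rw [mul_div_mul_left _ _ hσQ]
    rw [e]
    exact hG
  rw [hcγ]
  -- `q^m ≡ (σ₀σ) q^{m'} (mod N)`
  rw [hDmod] at hC
  have hσ₀Z : ((σ₀ : ℤ) : ZMod N) * (σ₀ : ZMod N) = 1 := by rcases hσ₀ with rfl | rfl <;> push_cast <;> ring
  have hC' : (q : ZMod N) ^ m = ((σ₀ * σ : ℤ) : ZMod N) * (q : ZMod N) ^ m' := by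
    push_cast
    linear_combination ((σ₀ : ℤ) : ZMod N) * hC - ((q : ZMod N) ^ m) * hσ₀Z
  have hunit : ∀ n : ℕ, IsUnit ((q : ZMod N) ^ n) := fun n ↦ (huq ▸ Units.isUnit uq).pow n
  rcases (show σ₀ * σ = 1 ∨ σ₀ * σ = -1 by rcases hσ₀ with rfl | rfl <;> rcases hσ with rfl | rfl <;> norm_num) with hτ | hτ
  · -- same sign: `m ≡ m' (mod o)`
    rw [hτ, Int.cast_one, one_mul] at hC'
    have hpow : uq ^ m = uq ^ m' := by
      apply Units.val_injective
      rw [Units.val_pow_eq_pow_val, Units.val_pow_eq_pow_val, huq]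
      exact hC'
    have hmod : m ≡ m' [MOD o] := by rw [ho]; exact pow_eq_pow_iff_modEq.mp hpow
    obtain ⟨k, hk⟩ := (Nat.modEq_iff_dvd.mp hmod)
    have : κ' * (m' : ZMod p) - κ' * (m : ZMod p) = κ' * ((((m' : ℤ) - (m : ℤ) : ℤ)) : ZMod p) := by push_cast; ring
    rw [this, hk]
    push_cast
    linear_combination ((k : ℤ) : ZMod p) * hκo
  · -- opposite signs: a power of `q` is `≡ -1`
    rw [hτ] at hC'
    push_cast at hC'
    rcases le_or_gt m' m with hle | hlt
    · obtain ⟨d, rfl⟩ := Nat.exists_eq_add_of_le hle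
      have hd : (q : ZMod N) ^ d = -1 := by
        rw [pow_add] at hC'
        have h := (hunit m').mul_left_cancel (hC'.trans (by ring : -1 * (q : ZMod N) ^ m' = (q : ZMod N) ^ m' * (-1)))
        exact h
      have := hκneg d hd
      push_cast
      linear_combination (-1 : ZMod p) * this
    · obtain ⟨d, rfl⟩ := Nat.exists_eq_add_of_lt hlt
      have hd : (q : ZMod N) ^ (d + 1) = -1 := by
        rw [show m + d + 1 = m + (d + 1) by ring, pow_add] at hC'
        have h := (hunit m).mul_left_cancel
          ((by ring : (q : ZMod N) ^ m * 1 = (q : ZMod N) ^ m).trans (hC'.trans (by ring)) :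
            (q : ZMod N) ^ m * 1 = (q : ZMod N) ^ m * (-(q : ZMod N) ^ (d + 1)))
        linear_combination h
      have := hκneg (d + 1) hd
      push_cast at this ⊢
      linear_combination this

end Summit.BirchSwinnertonDyer.BirchSwinnertonDyer.Theorems.ManinLocalTwoThree
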